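import Summits.HodgeConjecture.HodgeConjecture.Theorems.MarkmanPartnerTransportPicardThreeK3SquaresQuotientSimilitudeSectors
import Summits.HodgeConjecture.HodgeConjecture.Theorems.MarkmanPartnerTransportPicardThreeK3SquaresResidue

/-!
# Route MarkmanPartnerTransport · crux `PicardThreeK3Squares` (stmt-HodgeConjecture-19652) —
# the residue of the crux on FIVE named facts

The residue chain `…Residue → …ResidueSqrtTwo → …ResidueSqrtThree → …ResidueSqrtSix` (gens 2–4) pins the
crux `PicardThreeK3Squares` to the cycle-induced sector clause on the non-CM, non-scalar projective K3
surfaces with `ρ ∈ {4,6,7,8,10,12,13,14,16}` off the Kuga–Satake sector and without `√2`- (`ρ ≥ 12`),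
`√3`-, `√6`-multiplication (`ρ ≥ 15`) — modulo TEN named facts. With gen 5's re-basing of the `√2`- and
`√3`-sectors on Varesco's quotient similitudes (`…QuotientSimilitudeSectors`) and gen 4's reduction of
`Huybrechts2019_transcendentalHodgeIsometry_algebraic` to Buskin (`…TranscendentalBuskin`), the SAME
residue statement holds modulo FIVE named facts:
`Buskin2019_hodgeIsometry_algebraic`, `Huybrechts_K3_marking_exists`,
`Floccari2026_hodgeClasses_algebraic_powers_of_K3_of_transcendental_embedding`,
`Varesco2023_quotientSimilitude_two_of_transcendental_embedding`,
`Varesco2023_quotientSimilitude_three_of_transcendental_embedding` — dropping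
`Huybrechts_K3_periodSurjective_projective`, `Varesco2023_sqrtMultiplication_algebraic_of_symplecticAutomorphism`,
`VanGeemenSarti2007_nikulinInvolution_of_primitiveE8`, `Varesco2023_sqrtThree_algebraic_of_transcendental_embedding`
and `Huybrechts2019_transcendentalHodgeIsometry_algebraic`.

* `picardThreeK3Squares_of_residue_quotient` / `picardThreeK3Squares_iff_residue_quotient` — **modulo
  the five named facts, `PicardThreeK3Squares` is EQUIVALENT to the cycle-induced sector clause on the
  non-CM, non-scalar projective K3 surfaces `S` with `ρ(S) ≥ 3`, `22 − ρ(S) = e·m` (`e ≥ 2`, `m ≥ 3`),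
  `T(S)_ℚ ≇ U_ℚ² ⊕ ⟨a⟩ ⊕ ⟨b⟩`, WITHOUT `√2`-multiplication when `ρ(S) ≥ 12`, WITHOUT `√3`- and WITHOUT
  `√6`-multiplication when `ρ(S) ≥ 15`** — the exact open content of item stmt-HodgeConjecture-19652
  after gens 0–5 of the prover lane, as one kernel statement on the smallest set of inputs so far.

No definition, no sorry; named facts only as hypotheses. Prover seat hodge-nonav-19652-p1 (gen 5),
`--supports stmt-HodgeConjecture-19652`.

References: Varesco, Math. Z. 305 (2023) §2; Floccari, Geom. Topol. 30 (2026) Thm. 5.11; Buskin, J.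
reine angew. Math. 755 (2019) Thm. 1.1; van Geemen, Michigan Math. J. 56 (2008) Lemma 3.2.
-/

set_option linter.dupNamespace false

noncomputable section

namespace Summit.HodgeConjecture.HodgeConjecture.Theorems.MarkmanPartnerTransport.Residue

open scoped Manifold
open CategoryTheory MonoidalCategory CartesianMonoidalCategory
open Literature.AlgebraicGeometry Literature.AlgebraicGeometry.Motives Literature.AlgebraicGeometry.HodgeTheory
open Literature.AlgebraicGeometry.Surfaces
open Literature.AlgebraicTopology.SingularHomology
open Summit.HodgeConjecture.HodgeConjecture.Theorems
open Summit.HodgeConjecture.HodgeConjecture.Theorems.MarkmanPartnerTransport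

/-- `Corr[μ, hS ; γ, y] = pr₁_*(pr₂^* y ∪ γ)` on `H²(S(ℂ); ℂ)`. Local notation only. -/
local notation3 (prettyPrint := false) "Corr[" μ ", " hS " ; " γ ", " y "]" =>
  complexGysin μ (IsSmoothProjective.tensor_holds hS hS) hS
    (SemiCartesianMonoidalCategory.fst _ _) (rfl : 2 * 1 + 2 * 2 + 2 * 2 = 2 * 1 + 2 * (2 + 2))
    (cupProduct (rfl : 2 * 1 + 2 * 2 = 2 * 1 + 2 * 2)
      (complexBetti.map (SemiCartesianMonoidalCategory.snd _ _) (2 * 1) y) γ)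

/-- `NoSqrtTwo[S]`: `S` carries NO real multiplication by `√2` at Picard rank `≥ 12` — every rational,
Hodge-type-preserving endomorphism `ψ` of `H²(S(ℂ); ℂ)` with `ψ² = 2` and multiplier `2` on `T(S)`
forces `ρ(S) < 12` (the complement of the sector of
`NikulinIsogeny.hodgeConjectureFor_square_of_twelve_le_of_sqrtTwo'`). Local notation only. -/
local notation3 (prettyPrint := false) "NoSqrtTwo[" S "]" =>
  (∀ ψ : complexBetti S (2 * 1) →ₗ[ℂ] complexBetti S (2 * 1),
    (∀ y, IsRationalClass y → IsRationalClass (ψ y)) →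
    (∀ (i j : ℕ) y, IsOfHodgeType 2 S (2 * 1) i j y → IsOfHodgeType 2 S (2 * 1) i j (ψ y)) →
    (∀ y ∈ transcendentalSubspace S, ψ (ψ y) = (2 : ℂ) • y) →
    (∀ y ∈ transcendentalSubspace S, ∀ z ∈ transcendentalSubspace S,
      cupProduct (rfl : 2 * 1 + 2 * 1 = 2 * 2) (ψ y) (ψ z) =
        (2 : ℂ) • cupProduct (rfl : 2 * 1 + 2 * 1 = 2 * 2) y z) →
    Module.finrank ℂ ↥(algebraicClasses S 1) < 12)

/-- `NoSqrtThree[S]`: `S` carries NO real multiplication by `√3` at Picard rank `≥ 15` — every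
rational, Hodge-type-preserving endomorphism `ψ` of `H²(S(ℂ); ℂ)` with `ψ² = 3` and multiplier `3` on
`T(S)` forces `ρ(S) < 15` (the complement of the sector of
`NikulinIsogeny.hodgeConjectureFor_square_of_fifteen_le_of_sqrtThree'`). Local notation only. -/
local notation3 (prettyPrint := false) "NoSqrtThree[" S "]" =>
  (∀ ψ : complexBetti S (2 * 1) →ₗ[ℂ] complexBetti S (2 * 1),
    (∀ y, IsRationalClass y → IsRationalClass (ψ y)) →
    (∀ (i j : ℕ) y, IsOfHodgeType 2 S (2 * 1) i j y → IsOfHodgeType 2 S (2 * 1) i j (ψ y)) →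
    (∀ y ∈ transcendentalSubspace S, ψ (ψ y) = (3 : ℂ) • y) →
    (∀ y ∈ transcendentalSubspace S, ∀ z ∈ transcendentalSubspace S,
      cupProduct (rfl : 2 * 1 + 2 * 1 = 2 * 2) (ψ y) (ψ z) =
        (3 : ℂ) • cupProduct (rfl : 2 * 1 + 2 * 1 = 2 * 2) y z) →
    Module.finrank ℂ ↥(algebraicClasses S 1) < 15)

/-- `NoSqrtSix[S]`: `S` carries NO real multiplication by `√6` at Picard rank `≥ 15`. Local notation only. -/
local notation3 (prettyPrint := false) "NoSqrtSix[" S "]" =>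
  (∀ ψ : complexBetti S (2 * 1) →ₗ[ℂ] complexBetti S (2 * 1),
    (∀ y, IsRationalClass y → IsRationalClass (ψ y)) →
    (∀ (i j : ℕ) y, IsOfHodgeType 2 S (2 * 1) i j y → IsOfHodgeType 2 S (2 * 1) i j (ψ y)) →
    (∀ y ∈ transcendentalSubspace S, ψ (ψ y) = (6 : ℂ) • y) →
    (∀ y ∈ transcendentalSubspace S, ∀ z ∈ transcendentalSubspace S,
      cupProduct (rfl : 2 * 1 + 2 * 1 = 2 * 2) (ψ y) (ψ z) =
        (6 : ℂ) • cupProduct (rfl : 2 * 1 + 2 * 1 = 2 * 2) y z) →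
    Module.finrank ℂ ↥(algebraicClasses S 1) < 15)

/-- `OpenClause[S, hS]`: the cycle-induced sector clause for `S` (for the complex orientation family),
under the hypothesis that `End_Hdg(T(S))` is not `ℚ` — VERBATIM the last two binders of
`Residue.picardThreeK3Squares_iff_residue`. Local notation only. -/
local notation3 (prettyPrint := false) "OpenClause[" S ", " hS "]" =>
  ((¬ ∀ (f : complexBetti S (2 * 1) →ₗ[ℂ] complexBetti S (2 * 1)),
      (∀ y, IsRationalClass y → IsRationalClass (f y)) →
      (∀ (i j : ℕ) y, IsOfHodgeType 2 S (2 * 1) i j y → IsOfHodgeType 2 S (2 * 1) i j (f y)) →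
      (∀ d ∈ algebraicClasses S 1, f d = 0) →
      (∀ y : complexBetti S (2 * 1), ∀ d ∈ algebraicClasses S 1,
        cupProduct (rfl : 2 * 1 + 2 * 1 = 2 * 2) (f y) d = 0) →
      ∃ a : ℚ, ∀ y : complexBetti S (2 * 1),
        (∀ d ∈ algebraicClasses S 1, cupProduct (rfl : 2 * 1 + 2 * 1 = 2 * 2) y d = 0) →
          f y = (a : ℂ) • y) →
    ∀ (f : complexBetti S (2 * 1) →ₗ[ℂ] complexBetti S (2 * 1)),
      (∀ y, IsRationalClass y → IsRationalClass (f y)) →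
      (∀ (i j : ℕ) y, IsOfHodgeType 2 S (2 * 1) i j y → IsOfHodgeType 2 S (2 * 1) i j (f y)) →
      (∀ d ∈ algebraicClasses S 1, f d = 0) →
      (∀ y : complexBetti S (2 * 1), ∀ d ∈ algebraicClasses S 1,
        cupProduct (rfl : 2 * 1 + 2 * 1 = 2 * 2) (f y) d = 0) →
      ∃ g : complexBetti S (2 * 1) →ₗ[ℂ] complexBetti S (2 * 1),
        (∀ d ∈ algebraicClasses S 1, g d ∈ algebraicClasses S 1) ∧
        (∃ γ ∈ algebraicClasses (S ⊗ S) 2, ∀ y : complexBetti S (2 * 1),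
          g y = Corr[complexOrientationFamily, IsK3Surface.isSmoothProjective hS ; γ, y]) ∧
        ∀ y : complexBetti S (2 * 1),
          (∀ d ∈ algebraicClasses S 1, cupProduct (rfl : 2 * 1 + 2 * 1 = 2 * 2) y d = 0) →
            f y = g y)

/-- **The crux from the cycle-induced sector clause on the residue after the Kuga–Satake, `√2`-,
`√3`- and `√6`-sectors, modulo FIVE named facts.** On the subtracted sectors HC for `S ⊗ S` holds —
`QuotientSimilitude.hodgeConjectureFor_square_of_twelve_le_of_sqrtTwo'` (Buskin, markings, quotient₂),
`QuotientSimilitude.hodgeConjectureFor_square_of_fifteen_le_of_sqrtThree'` (Buskin, markings, quotient₃),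
`SqrtSix.hodgeConjectureFor_square_of_fifteen_le_of_sqrtSix'` (with
`Huybrechts2019_transcendentalHodgeIsometry_algebraic` supplied by
`NikulinIsogeny.transcendentalHodgeIsometry_algebraic_of_buskin`) — and implies the clause
(`SectorIff.cycleInducedSector_of_hodgeConjectureFor_square`); the rest is gen 2's
`picardThreeK3Squares_of_residue` (Buskin, markings, Floccari). [cite: Varesco2023, §2 (p. 8), Prop. 2.5 and Prop. 2.11]
[cite: Floccari2026, Thm. 5.11 (§5)] [cite: Buskin2019, Thm. 1.1] [cite: Vangeemen2008, Lemma 3.2] -/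
theorem picardThreeK3Squares_of_residue_quotient (hB : Buskin2019_hodgeIsometry_algebraic)
    (hmark : Huybrechts_K3_marking_exists)
    (hF : Floccari2026_hodgeClasses_algebraic_powers_of_K3_of_transcendental_embedding)
    (hQ2 : Varesco2023_quotientSimilitude_two_of_transcendental_embedding)
    (hQ3 : Varesco2023_quotientSimilitude_three_of_transcendental_embedding)
    (hRM : ∀ (S : SchemeOver ℂ) (hS : IsK3Surface S), ¬ HasComplexMultiplication S →
      3 ≤ Module.finrank ℂ ↥(algebraicClasses S 1) →
      (∃ e m : ℕ, 2 ≤ e ∧ 3 ≤ m ∧ e * m + Module.finrank ℂ ↥(algebraicClasses S 1) = 22) →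
      (∀ a b : ℤ, a < 0 → b < 0 → ¬ HasTranscendentalLatticeU2ab S a b) →
      NoSqrtTwo[S] → NoSqrtThree[S] → NoSqrtSix[S] → OpenClause[S, hS]) :
    Summit.HodgeConjecture.HodgeConjecture.Theses.MarkmanPartnerTransport.PicardThreeK3Squares := by
  have hH : Huybrechts2019_transcendentalHodgeIsometry_algebraic :=
    NikulinIsogeny.transcendentalHodgeIsometry_algebraic_of_buskin hB
  refine picardThreeK3Squares_of_residue hB hmark hF fun S hS hCM h3 hem hU2 hQ => ?_
  have hC := SectorIff.cycleInducedSector_of_hodgeConjectureFor_square complexOrientationFamily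
    hS.isSmoothProjective
  by_cases hψ2 : ∃ ψ : complexBetti S (2 * 1) →ₗ[ℂ] complexBetti S (2 * 1),
      (∀ y, IsRationalClass y → IsRationalClass (ψ y)) ∧
      (∀ (i j : ℕ) y, IsOfHodgeType 2 S (2 * 1) i j y → IsOfHodgeType 2 S (2 * 1) i j (ψ y)) ∧
      (∀ y ∈ transcendentalSubspace S, ψ (ψ y) = (2 : ℂ) • y) ∧
      (∀ y ∈ transcendentalSubspace S, ∀ z ∈ transcendentalSubspace S,
        cupProduct (rfl : 2 * 1 + 2 * 1 = 2 * 2) (ψ y) (ψ z) =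
          (2 : ℂ) • cupProduct (rfl : 2 * 1 + 2 * 1 = 2 * 2) y z) ∧
      12 ≤ Module.finrank ℂ ↥(algebraicClasses S 1)
  · obtain ⟨ψ, hψrat, hψtyp, hψsq, hψmul, hρ⟩ := hψ2
    exact hC (QuotientSimilitude.hodgeConjectureFor_square_of_twelve_le_of_sqrtTwo' hB hmark hQ2 hS hρ ψ
      hψrat hψtyp hψsq hψmul)
  by_cases hψ3 : ∃ ψ : complexBetti S (2 * 1) →ₗ[ℂ] complexBetti S (2 * 1),
      (∀ y, IsRationalClass y → IsRationalClass (ψ y)) ∧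
      (∀ (i j : ℕ) y, IsOfHodgeType 2 S (2 * 1) i j y → IsOfHodgeType 2 S (2 * 1) i j (ψ y)) ∧
      (∀ y ∈ transcendentalSubspace S, ψ (ψ y) = (3 : ℂ) • y) ∧
      (∀ y ∈ transcendentalSubspace S, ∀ z ∈ transcendentalSubspace S,
        cupProduct (rfl : 2 * 1 + 2 * 1 = 2 * 2) (ψ y) (ψ z) =
          (3 : ℂ) • cupProduct (rfl : 2 * 1 + 2 * 1 = 2 * 2) y z) ∧
      15 ≤ Module.finrank ℂ ↥(algebraicClasses S 1)
  · obtain ⟨ψ, hψrat, hψtyp, hψsq, hψmul, hρ⟩ := hψ3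
    exact hC (QuotientSimilitude.hodgeConjectureFor_square_of_fifteen_le_of_sqrtThree' hB hmark hQ3 hS hρ ψ
      hψrat hψtyp hψsq hψmul)
  by_cases hψ6 : ∃ ψ : complexBetti S (2 * 1) →ₗ[ℂ] complexBetti S (2 * 1),
      (∀ y, IsRationalClass y → IsRationalClass (ψ y)) ∧
      (∀ (i j : ℕ) y, IsOfHodgeType 2 S (2 * 1) i j y → IsOfHodgeType 2 S (2 * 1) i j (ψ y)) ∧
      (∀ y ∈ transcendentalSubspace S, ψ (ψ y) = (6 : ℂ) • y) ∧
      (∀ y ∈ transcendentalSubspace S, ∀ z ∈ transcendentalSubspace S,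
        cupProduct (rfl : 2 * 1 + 2 * 1 = 2 * 2) (ψ y) (ψ z) =
          (6 : ℂ) • cupProduct (rfl : 2 * 1 + 2 * 1 = 2 * 2) y z) ∧
      15 ≤ Module.finrank ℂ ↥(algebraicClasses S 1)
  · obtain ⟨ψ, hψrat, hψtyp, hψsq, hψmul, hρ⟩ := hψ6
    exact hC (SqrtSix.hodgeConjectureFor_square_of_fifteen_le_of_sqrtSix' hB hmark hQ2 hQ3 hH hS hρ ψ
      hψrat hψtyp hψsq hψmul)
  push Not at hψ2 hψ3 hψ6
  exact hRM S hS hCM h3 hem hU2 (fun ψ hψrat hψtyp hψsq hψmul => hψ2 ψ hψrat hψtyp hψsq hψmul)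
    (fun ψ hψrat hψtyp hψsq hψmul => hψ3 ψ hψrat hψtyp hψsq hψmul)
    (fun ψ hψrat hψtyp hψsq hψmul => hψ6 ψ hψrat hψtyp hψsq hψmul) hQ

/-- **The crux is EQUIVALENT to the clause on the residue, modulo the FIVE named facts**
`Buskin2019_hodgeIsometry_algebraic`, `Huybrechts_K3_marking_exists`,
`Floccari2026_hodgeClasses_algebraic_powers_of_K3_of_transcendental_embedding`,
`Varesco2023_quotientSimilitude_two/three_of_transcendental_embedding`. What is left of item
stmt-HodgeConjecture-19652: the real-multiplication K3 surfaces with `ρ ∈ {4, 6, 7, 8, 10, 13}`, those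
with `ρ ∈ {12, 14}` without `√2`-multiplication, and those with `ρ = 16`, `T(S)_ℚ` of Witt index `1`,
with real multiplication by `ℚ(√d)`, `d ∉ {2, 3, 6}`. [cite: Varesco2023, §2 (p. 8)] [cite: GeemenSchutt2023, §2.1]
[cite: Floccari2026, Thm. 5.11 (§5)] [cite: Buskin2019, Thm. 1.1] -/
theorem picardThreeK3Squares_iff_residue_quotient (hB : Buskin2019_hodgeIsometry_algebraic)
    (hmark : Huybrechts_K3_marking_exists)
    (hF : Floccari2026_hodgeClasses_algebraic_powers_of_K3_of_transcendental_embedding)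
    (hQ2 : Varesco2023_quotientSimilitude_two_of_transcendental_embedding)
    (hQ3 : Varesco2023_quotientSimilitude_three_of_transcendental_embedding) :
    Summit.HodgeConjecture.HodgeConjecture.Theses.MarkmanPartnerTransport.PicardThreeK3Squares ↔
    ∀ (S : SchemeOver ℂ) (hS : IsK3Surface S), ¬ HasComplexMultiplication S →
      3 ≤ Module.finrank ℂ ↥(algebraicClasses S 1) →
      (∃ e m : ℕ, 2 ≤ e ∧ 3 ≤ m ∧ e * m + Module.finrank ℂ ↥(algebraicClasses S 1) = 22) →
      (∀ a b : ℤ, a < 0 → b < 0 → ¬ HasTranscendentalLatticeU2ab S a b) →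
      NoSqrtTwo[S] → NoSqrtThree[S] → NoSqrtSix[S] → OpenClause[S, hS] :=
  ⟨fun h S hS _ h3 _ _ _ _ _ _ =>
    SectorIff.cycleInducedSector_of_picardThreeK3Squares h hmark complexOrientationFamily S hS h3,
   fun h => picardThreeK3Squares_of_residue_quotient hB hmark hF hQ2 hQ3 h⟩

end Summit.HodgeConjecture.HodgeConjecture.Theorems.MarkmanPartnerTransport.Residue

end
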